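import Summits.BirchSwinnertonDyer.Rank1Residual.Additive.X4ExoticNine
import Summits.BirchSwinnertonDyer.Rank1Residual.GaloisImage.WildThreeAdicTowerJForm
import HarnessLib

/-!
# The EXOTIC residue of X4 at `3` after BOTH arms of row T-b10 'wild tower at 3': wild cell (w) ∧
# `v₃(j − 1728) ∈ {0, 3}` (ARM A, n1011-p02: the tower on `v₃(j − 1728) ∈ {1, 2, 4} ∪ [5, ∞)`) ∧ no
# level-`9` `j`-witness (ARM B, n1011-p14) (cell `b2b-bsdres`, team n1011, seat p14 gen 2 — the
# class-side assembly of T-b10 per lead R5-33; sequel of `Additive/X4ExoticNine.lean` p260856 and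
# n1011-p02's `GaloisImage/WildThreeAdicTowerJForm.lean`)

HONEST FRAMING (cell `b2b-bsdres`, run/shared/lean/b2b/bsd-rank1-residual/, verbatim in every
file): the goal of the cell is to DELETE the COMBINATION-SHAPED residual classes of the
Birch–Swinnerton-Dyer formula for ALL analytic-rank `≤ 1` elliptic curves over `ℚ` — "full BSD
formula for every rank `≤ 1` curve in class `C`" assembled STRICTLY from published theorems — so
that the rank-`≤ 1` remainder becomes exactly the CONSTRUCTION-SHAPED classes, which are TYPED
(missing-input `Prop`s), NOT attempted. This is not "finishing BSD". Team n1011 (N10 / N11, the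
additive block X4 ∧ `p = 3`): research route; no claim beyond the stated classes; the label X4 is
UNCHANGED by this file; nothing is booked. Theorems only (no definition, no named fact minted; every
published input of the end-state is an explicit named-fact hypothesis, as in p250513 / p251574).

## What this file proves

For `W/ℚ` elliptic and globally minimal with `ClassX4 W 3` and `ρ̄_{E,3}` onto:

* §1 `ClassX4.towerSurj_three_of_surj_of_padicValRat_j_sub_ne_three` — ARM A in class currency:
  `v₃(j − 1728) = m ≥ 1`, `m ≠ 3` ⟹ the tower (n1011-p02's
  `towerSurj_three_of_surj_of_padicValRat_j_sub_ne_three`: `m ∈ {1,2,4}` by `WildThreeAdicTower`,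
  `m ≥ 5` by `WildFiveThreeAdicTower`);
  `padicValRat_j_sub_1728_nonneg_of_subW` — on the cell (w) (`ord₃ j ≥ 0`) one has
  `v₃(j − 1728) ≥ 0` (`min(v₃ j, v₃ 1728) ≤ v₃(j − 1728)`), so ARM A's alternative "`= 3` or `≤ 0`"
  reads "`= 3` or `= 0`".
* §2 **`ClassX4.exotic_arms_of_not_towerSurj_three` — THE EXOTIC SIGNATURE AFTER BOTH ARMS**: a
  failing tower forces (w) (`SubW W 3`: `ord₃ j ≥ 0 ∧ f₃ ≠ 2`, Kodaira `II/IV/IV*/II*`), AND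
  `v₃(j − 1728) = 3 ∨ v₃(j − 1728) = 0` (ARM A; the census sees only `3` — Elkies' value — on the wild
  rows, `0` is not excluded by a theorem), AND `9 ∣ ord_q j` at every prime `q ≠ 3` with `ord_q j < 0`
  (ARM B, `ClassX4.exotic_signature_of_not_towerSurj_three`, p260856).
* §3 `exotic_iff_exotic_of_arms` and the END-STATE
  **`x4SharpUnitFree_iff_lower_and_residues_sharp_exoticArms_noL20`** — p251574's eight-fact X4
  end-state with the EXOTIC piece quantified ONLY over the rows carrying that signature.

Census reading (EVIDENCE, `HOME/b2b-bsdres-n1011-p14/tb1/T-b1-ENGINE1-v1.4-ADDENDUM.md`; second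
sources referee 2 GEN 10 and p02 `wild/census_m.py`): of the 1 772 surj(3) wild X4@3 `r_an = 0` cells
that needed a mod-`9` certificate, ARM A covers 1 090 (`m ∈ {1,2,4}`) + 177 (`m = 5`), ARM B 631; the
signature of §2 holds on exactly **341** cells, all with `v₃(j − 1728) = 3` (`v₃(N) = 5`: II 58 /
IV 33 / IV* 69 / II* 50; `v₃(N) = 3`: II 60 / IV* 71).  Nothing booked; X4 CONSTRUCTION-SHAPED; no
label change.

References: [Wuthrich2014] Lemma 20 (p. 399); [SerreAbelianLadic1968] IV §3.4 Lemma 3, A.1.2;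
[SilvermanATAEC1994] V.5.3, Ex. 5.13(b); [Elkies2006] arXiv:math/0612734; [Kato2004Asterisque]
Thm. 14.5 (3).
-/

noncomputable section

open scoped Classical

open WeierstrassCurve Literature.NumberTheory.EllipticCurves
  Literature.NumberTheory.EllipticCurves.ModularForms
  Literature.NumberTheory.EllipticCurves.Rank1Residual
  Literature.NumberTheory.EllipticCurves.Rank1Residual.Typed
  Summit.BirchSwinnertonDyer.Rank1Residual.GaloisImage

namespace Summit.BirchSwinnertonDyer.Rank1Residual.Additive

section Arms

variable {W : WeierstrassCurve ℚ} [W.IsElliptic] [W.IsGloballyMinimal]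

omit [W.IsGloballyMinimal] in
/-- **ARM A in class currency: the tower on every X4 row at `3` with `v₃(j − 1728) = m ≥ 1`,
`m ≠ 3`** from surj(3) alone — no binder, no certificate (n1011-p02's
`towerSurj_three_of_surj_of_padicValRat_j_sub_ne_three`). [cite: SerreAbelianLadic1968, Ch. IV §3.4, Lemma 3 (IV-23)] -/
theorem ClassX4.towerSurj_three_of_surj_of_padicValRat_j_sub_ne_three [Fact (Nat.Prime 3)]
    (_hX : ClassX4 W 3) (hsurj : Surj W 3) {m : ℕ} (hm1 : 1 ≤ m) (hm3 : m ≠ 3)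
    (hj : padicValRat 3 (W.j - 1728) = m) (n : ℕ) : W.HasSurjectiveModNGaloisRep (3 ^ n : ℕ) :=
  Summit.BirchSwinnertonDyer.Rank1Residual.GaloisImage.towerSurj_three_of_surj_of_padicValRat_j_sub_ne_three
    W hm1 hm3 hj hsurj n

omit [W.IsGloballyMinimal] in
/-- On the wild cell (w) — indeed whenever `ord₃ j ≥ 0` — `v₃(j − 1728) ≥ 0`
(`min (v₃ j) (v₃ 1728) ≤ v₃(j − 1728)`; `j = 1728` gives Mathlib's `padicValRat 3 0 = 0`).
[folklore] -/
theorem padicValRat_j_sub_1728_nonneg_of_subW [Fact (Nat.Prime 3)] (hS : SubW W 3) :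
    0 ≤ padicValRat 3 (W.j - 1728) := by
  have hj : 0 ≤ padicValRat 3 W.j := by
    have h := hS.1
    unfold PotMult at h
    exact not_lt.mp h
  by_cases h0 : W.j - 1728 = 0
  · rw [h0, padicValRat.zero]
  · have h1728 : (0 : ℤ) ≤ padicValRat 3 (-1728 : ℚ) := by
      rw [padicValRat.neg, show (1728 : ℚ) = ((1728 : ℕ) : ℚ) by norm_num, padicValRat.of_nat]
      exact_mod_cast Nat.zero_le _
    have hne : W.j + (-1728) ≠ 0 := by rwa [← sub_eq_add_neg]
    have hmin := padicValRat.min_le_padicValRat_add (p := 3) hne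
    rw [← sub_eq_add_neg] at hmin
    exact le_trans (le_min hj h1728) hmin

/-- **THE EXOTIC SIGNATURE AFTER BOTH ARMS OF T-b10.**  An X4 pair at `3` with `ρ̄_{E,3}` onto whose
`3`-adic tower FAILS is in the wild cell (w) (`SubW W 3`), has `v₃(j − 1728) = 3` or `= 0` (ARM A,
n1011-p02: `padicValRat_j_sub_eq_three_or_nonpos_of_not_towerSurj_three` with §1's non-negativity),
and has `9 ∣ ord_q j` at every prime `q ≠ 3` with `ord_q j < 0` (ARM B,
`ClassX4.exotic_signature_of_not_towerSurj_three`).  Census: `v₃(j − 1728) = 3` on every such cell.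
[cite: Wuthrich2014, Lemma 20 (p. 399)] [cite: SerreAbelianLadic1968, Ch. IV §3.4, Lemma 3 and A.1.2] [cite: Elkies2006, §1] -/
theorem ClassX4.exotic_arms_of_not_towerSurj_three [Fact (Nat.Prime 3)] (hX : ClassX4 W 3)
    (hsurj : Surj W 3) (hnot : ¬ ∀ n : ℕ, W.HasSurjectiveModNGaloisRep (3 ^ n : ℕ)) :
    SubW W 3 ∧ (padicValRat 3 (W.j - 1728) = 3 ∨ padicValRat 3 (W.j - 1728) = 0) ∧
    ∀ q : ℕ, q.Prime → q ≠ 3 → padicValRat q W.j < 0 → (9 : ℤ) ∣ padicValRat q W.j := by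
  obtain ⟨hS, h9⟩ := ClassX4.exotic_signature_of_not_towerSurj_three hX hsurj hnot
  refine ⟨hS, ?_, h9⟩
  rcases padicValRat_j_sub_eq_three_or_nonpos_of_not_towerSurj_three W hsurj hnot with h | h
  · exact Or.inl h
  · exact Or.inr (le_antisymm h (padicValRat_j_sub_1728_nonneg_of_subW hS))

end Arms

/-! ### The X4 end-state with the EXOTIC piece on the two-arm signature rows only -/

/-- **The EXOTIC hypothesis RESTRICTED to the two-arm signature.**  p251574's EXOTIC piece
(`p = 3`, `r_an = 0`, X4, surj(3), `ord₃ j ≥ 0`, `¬ TypeG W 3`, tower fails ⟹ upper) is EQUIVALENT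
to the same statement on the rows with `SubW W 3`, `v₃(j − 1728) ∈ {3, 0}` and `9 ∣ ord_q j` at
every prime `q ≠ 3` with `ord_q j < 0`. [cite: Wuthrich2014, Lemma 20 (p. 399)]
[cite: SerreAbelianLadic1968, Ch. IV §3.4, Lemma 3 (IV-23)] [cite: Elkies2006, §1] -/
theorem exotic_iff_exotic_of_arms :
    (∀ (W : WeierstrassCurve ℚ) [W.IsElliptic] [W.IsGloballyMinimal],
        W.analyticRank = 0 → ClassX4 W 3 → Surj W 3 → 0 ≤ padicValRat 3 W.j → ¬ TypeG W 3 →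
        ¬ (∀ n : ℕ, W.HasSurjectiveModNGaloisRep (3 ^ n : ℕ)) → MissingUpperBoundAt W 3) ↔
    (∀ (W : WeierstrassCurve ℚ) [W.IsElliptic] [W.IsGloballyMinimal],
        W.analyticRank = 0 → ClassX4 W 3 → Surj W 3 → SubW W 3 →
        (padicValRat 3 (W.j - 1728) = 3 ∨ padicValRat 3 (W.j - 1728) = 0) →
        (∀ q : ℕ, q.Prime → q ≠ 3 → padicValRat q W.j < 0 → (9 : ℤ) ∣ padicValRat q W.j) →
        ¬ (∀ n : ℕ, W.HasSurjectiveModNGaloisRep (3 ^ n : ℕ)) → MissingUpperBoundAt W 3) := by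
  haveI : Fact (Nat.Prime 3) := ⟨Nat.prime_three⟩
  rw [exotic_iff_exotic_of_signature]
  constructor
  · intro h V _ _ hr hX hs hS _ h9 hnot
    exact h V hr hX hs hS h9 hnot
  · intro h V _ _ hr hX hs hS h9 hnot
    exact h V hr hX hs hS (ClassX4.exotic_arms_of_not_towerSurj_three hX hs hnot).2.1 h9 hnot

/-- **THE END-STATE OF CLASS X4 ON EIGHT NAMED FACTS with the EXOTIC piece on the TWO-ARM
SIGNATURE rows only: X4♯(unit-free) ⟺ LOWER ∧ EXOTIC((w) ∧ `v₃(j−1728) ∈ {3, 0}` ∧ no level-9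
`j`-witness) ∧ TAM-DEFECT₂♭ ∧ ODD-SHA♭ ∧ MANIN♭** — p251574's
`x4SharpUnitFree_iff_lower_and_residues_sharp_exoticTypeG_noL20` rewritten along
`exotic_iff_exotic_of_arms`.  No named fact beyond the eight; X4 stays CONSTRUCTION-SHAPED; nothing
booked. [cite: Kato2004Asterisque, Thm. 14.5 (3) (p. 236), Thm. 17.4 (3) (p. 273)]
[cite: Delbourgo1998, Prop. 4 (p. 144)] [cite: Wuthrich2014, Lemma 20 (p. 399)] [cite: SilvermanAEC2009, Thm. X.4.14]
[cite: Kim2022StructureSelmer, Conj. 1.10 (PDF p. 8)] [cite: Miller2011LMS, Def. 1.1] [cite: Elkies2006, §1] -/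
theorem x4SharpUnitFree_iff_lower_and_residues_sharp_exoticArms_noL20
    (hCT : exists_casselsTate_pairing (K := ℚ))
    (hKatoS : Kato2004.rankZero_padicValNat_sha_le_sub_localTamagawa_of_additive_potGood_of_imageContainsSL2)
    (hDel : Delbourgo1998.prop4_rankZero_pow_dvd_constantCoeff)
    (hGZK : rank_eq_analyticRank_of_analyticRank_le_one) (hmod : hasEntireLFunction_rat)
    (hmodD : nonempty_modularParametrizationData)
    (hKatoχ : Wuthrich2014.kato_halfEigenCharIdeal_dvd_cyclotomicPrime_of_surjective)
    (hK : Kato2004.charIdeal_dvd_padicLFunctionBranch_component_of_surjective) :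
    X4SharpUnitFree ↔
      (∀ (W : WeierstrassCurve ℚ) [W.IsElliptic] [W.IsGloballyMinimal] (p : ℕ) [Fact p.Prime],
          W.analyticRank = 0 → ClassX4 W p → Surj W p → MissingLowerBoundAt W p) ∧
      (∀ (W : WeierstrassCurve ℚ) [W.IsElliptic] [W.IsGloballyMinimal],
          W.analyticRank = 0 → ClassX4 W 3 → Surj W 3 → SubW W 3 →
          (padicValRat 3 (W.j - 1728) = 3 ∨ padicValRat 3 (W.j - 1728) = 0) →
          (∀ q : ℕ, q.Prime → q ≠ 3 → padicValRat q W.j < 0 → (9 : ℤ) ∣ padicValRat q W.j) →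
          ¬ (∀ n : ℕ, W.HasSurjectiveModNGaloisRep (3 ^ n : ℕ)) → MissingUpperBoundAt W 3) ∧
      (∀ (W : WeierstrassCurve ℚ) [W.IsElliptic] [W.IsGloballyMinimal] (p : ℕ) [Fact p.Prime],
          W.analyticRank = 0 → ClassX4 W p → Surj W p → 0 ≤ padicValRat p W.j →
          ¬ (TypeGOrd W p ∧ semistabilityIndex W p = 2) →
          padicValNat p ((W.baseChange ℚ_[p]).localTamagawaNumber ℤ_[p]) + 2 ≤
            padicValNat p W.tamagawaProduct →
          MissingUpperBoundAt W p) ∧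
      (∀ (W : WeierstrassCurve ℚ) [W.IsElliptic] [W.IsGloballyMinimal] (p : ℕ) [Fact p.Prime],
          W.analyticRank = 0 → ClassX4 W p → Surj W p → 0 ≤ padicValRat p W.j →
          ¬ (TypeGOrd W p ∧ semistabilityIndex W p = 2) →
          (∃ q : ℚ, shaAn W = (q : ℂ) ∧ Odd (padicValRat p q)) → MissingUpperBoundAt W p) ∧
      (∀ (W : WeierstrassCurve ℚ) [W.IsElliptic] [W.IsGloballyMinimal] (p : ℕ) [Fact p.Prime],
          W.analyticRank = 0 → ClassX4 W p → Surj W p → 0 ≤ padicValRat p W.j →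
          ¬ (TypeGOrd W p ∧ semistabilityIndex W p = 2) →
          (∀ (N : ℕ) [NeZero N] (D : ModularParametrizationData W N), (p : ℤ) ∣ D.maninConstant) →
          MissingUpperBoundAt W p) := by
  rw [x4SharpUnitFree_iff_lower_and_residues_sharp_exoticTypeG_noL20 hCT hKatoS hDel hGZK hmod hmodD
    hKatoχ hK, exotic_iff_exotic_of_arms]

end Summit.BirchSwinnertonDyer.Rank1Residual.Additive

end
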